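import Literature.NumberTheory.Transcendental.KZCalculus
import Literature.NumberTheory.Transcendental.SemialgebraicMapsProofs

/-!
# `AperySectorThreeTwo` (stmt-KontsevichZagierPeriods-3873): negative side V.a — the fibre-integration
# invariant that kills rules (1) + (3)

Part 1/4 of "a change of variables (rule 2) is NECESSARY for `AperySectorThreeTwo`" (cdisprove
unit, cycle 3; headline in `Negative/NeedsChangeOfVariables.lean`). PROVED here (0 `sorry`):

* §1–§2 `pint`, `T`: integrate out the LAST coordinate (`Fin.snoc` fibres, Fubini through
  `MeasurableEquiv.piFinSuccAbove`), iterated down to dimension `2`; a.e.-congruence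
  (`pint_congr_ae`, `T_congr_ae`) and a.e.-additivity on integrable functions (`T_add_ae`).
* §3 the invariant `Φ : KZ.FormalRep →+ (ℝ² → ℝ)`, `[r] ↦ T n (1_σ · f)`, and the subgroup
  `aeSemialg` of functions a.e. equal to a `ℚ`-semialgebraic function on `ℝ²` (closed under `+`
  by the PROVED Tarski–Seidenberg consequence `IsSemialgebraicFunOn.add_holds`); extension by zero
  keeps semialgebraicity (`isSemialgebraicFunOn_indicator_univ`, no Tarski–Seidenberg).
* §4 `addNLRelations_le_comap`: `Φ` maps `closure (domainAddRel ∪ integrandAddRel ∪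
  newtonLeibnizRel)` into `aeSemialg` — additivity relations and Newton–Leibniz relations with base
  dimension `≥ 2` go to a.e.-zero functions (fibrewise FTC `pint_indicator_band_ae`, verbatim the
  soundness argument `KZ.eval_eq_zero_of_mem_newtonLeibnizRel_holds`), base dimension `1` to the
  band integrand itself (semialgebraic), base dimension `0` to `0`. The mechanism: rule (3)
  integrates along the LAST coordinate only, and without rule (2) no other coordinate can be moved
  there, so "integrate out everything above coordinate 1" is respected by every (1)+(3)-chain.

Sources: M. Kontsevich, D. Zagier, *Periods* (2001), §1.2 (the rules); folklore measure theory.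
-/

noncomputable section

open MeasureTheory Set Filter Topology
open Literature.NumberTheory.Transcendental Literature.ModelTheory.ExponentialFields

namespace Summit.KontsevichZagierPeriods.Theorems.AperySectorThreeTwo.Negative

namespace NeedsCoV

/-! ## §1 Partial integration along the last coordinate -/

/-- Integrate out the LAST coordinate: `pint g x = ∫ t, g (x, t)`. [folklore] -/
def pint {n : ℕ} (g : (Fin (n + 1) → ℝ) → ℝ) : (Fin n → ℝ) → ℝ := fun x => ∫ t, g (Fin.snoc x t)

/-- `ℝⁿ⁺¹ ≃ᵐ ℝⁿ × ℝ`, `z ↦ (init z, z last)`. [folklore] -/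
def splitLast (n : ℕ) : (Fin (n + 1) → ℝ) ≃ᵐ (Fin n → ℝ) × ℝ :=
  (MeasurableEquiv.piFinSuccAbove (fun _ => ℝ) (Fin.last n)).trans MeasurableEquiv.prodComm

/-- Auxiliary: `splitLast_symm_apply`. [folklore] -/
theorem splitLast_symm_apply (n : ℕ) (p : (Fin n → ℝ) × ℝ) :
    (splitLast n).symm p = Fin.snoc p.1 p.2 := by
  simp [splitLast, MeasurableEquiv.piFinSuccAbove, Fin.snocEquiv, MeasurableEquiv.prodComm,
    MeasurableEquiv.trans]

/-- Auxiliary: `measurePreserving_splitLast`. [folklore] -/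
theorem measurePreserving_splitLast (n : ℕ) :
    MeasurePreserving (splitLast n) volume ((volume : Measure (Fin n → ℝ)).prod volume) := by
  have h1 : MeasurePreserving (MeasurableEquiv.piFinSuccAbove (fun _ => ℝ) (Fin.last n))
      volume ((volume : Measure ℝ).prod volume) := by
    have := volume_preserving_piFinSuccAbove (fun _ : Fin (n + 1) => ℝ) (Fin.last n)
    rwa [Measure.volume_eq_prod] at this
  have h2 : MeasurePreserving (MeasurableEquiv.prodComm : ℝ × (Fin n → ℝ) ≃ᵐ (Fin n → ℝ) × ℝ)
      ((volume : Measure ℝ).prod volume) ((volume : Measure (Fin n → ℝ)).prod volume) :=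
    Measure.measurePreserving_swap
  exact h2.comp h1

/-- Auxiliary: `integrable_comp_snoc_iff`. [folklore] -/
theorem integrable_comp_snoc_iff {n : ℕ} {g : (Fin (n + 1) → ℝ) → ℝ} :
    Integrable (fun p : (Fin n → ℝ) × ℝ => g (Fin.snoc p.1 p.2))
        ((volume : Measure (Fin n → ℝ)).prod volume) ↔ Integrable g := by
  have h := ((measurePreserving_splitLast n).symm (splitLast n)).integrable_comp_emb
    (splitLast n).symm.measurableEmbedding (g := g)
  rw [← h]
  exact Iff.of_eq (by congr 1; ext p; simp [splitLast_symm_apply])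

/-- Auxiliary: `ae_comp_snoc_of_ae`. [folklore] -/
theorem ae_comp_snoc_of_ae {n : ℕ} {g g' : (Fin (n + 1) → ℝ) → ℝ} (h : g =ᵐ[volume] g') :
    ∀ᵐ x : Fin n → ℝ, ∀ᵐ t : ℝ, g (Fin.snoc x t) = g' (Fin.snoc x t) := by
  have h1 := ((measurePreserving_splitLast n).symm (splitLast n)).quasiMeasurePreserving.ae_eq_comp h
  have h2 : (fun p : (Fin n → ℝ) × ℝ => g (Fin.snoc p.1 p.2)) =ᵐ[(volume : Measure (Fin n → ℝ)).prod volume]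
      (fun p => g' (Fin.snoc p.1 p.2)) := by
    filter_upwards [h1] with p hp
    simpa [Function.comp_def, splitLast_symm_apply] using hp
  exact Measure.ae_ae_of_ae_prod h2

/-- `pint` respects a.e. equality. [folklore] -/
theorem pint_congr_ae {n : ℕ} {g g' : (Fin (n + 1) → ℝ) → ℝ} (h : g =ᵐ[volume] g') :
    pint g =ᵐ[volume] pint g' := by
  filter_upwards [ae_comp_snoc_of_ae h] with x hx
  exact integral_congr_ae hx

/-- `pint` of an integrable function is integrable (Fubini). [folklore] -/
theorem integrable_pint {n : ℕ} {g : (Fin (n + 1) → ℝ) → ℝ} (hg : Integrable g) :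
    Integrable (pint g) :=
  (integrable_comp_snoc_iff.mpr hg).integral_prod_left

/-- `pint` is additive on integrable functions, a.e. [folklore] -/
theorem pint_add_ae {n : ℕ} {g g' : (Fin (n + 1) → ℝ) → ℝ} (hg : Integrable g) (hg' : Integrable g') :
    pint (g + g') =ᵐ[volume] pint g + pint g' := by
  filter_upwards [(integrable_comp_snoc_iff.mpr hg).prod_right_ae,
    (integrable_comp_snoc_iff.mpr hg').prod_right_ae] with x hx hx'
  exact integral_add hx hx'

/-- `pint` commutes with negation. [folklore] -/
theorem pint_neg {n : ℕ} (g : (Fin (n + 1) → ℝ) → ℝ) : pint (-g) = -pint g := by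
  funext x
  exact integral_neg _

/-! ## §2 The iterated operator `T n` (integrate out all coordinates of index `≥ 2`) -/

/-- `T n g`: for `n ≥ 2`, integrate out the coordinates `n−1, n−2, …, 2` (always the last one);
`0` in dimensions `0, 1`. [folklore] -/
def T : (n : ℕ) → ((Fin n → ℝ) → ℝ) → ((Fin 2 → ℝ) → ℝ)
  | 0, _ => 0
  | 1, _ => 0
  | 2, g => g
  | (n + 3), g => T (n + 2) (pint g)

/-- Auxiliary: `T_zero`. [folklore] -/
@[simp] theorem T_zero (g : (Fin 0 → ℝ) → ℝ) : T 0 g = 0 := rfl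
/-- Auxiliary: `T_one`. [folklore] -/
@[simp] theorem T_one (g : (Fin 1 → ℝ) → ℝ) : T 1 g = 0 := rfl
/-- Auxiliary: `T_two`. [folklore] -/
@[simp] theorem T_two (g : (Fin 2 → ℝ) → ℝ) : T 2 g = g := rfl
/-- Auxiliary: `T_succ` (definitional unfolding). [folklore] -/
theorem T_succ (n : ℕ) (g : (Fin (n + 3) → ℝ) → ℝ) : T (n + 3) g = T (n + 2) (pint g) := rfl

/-- `T (k+2)` respects a.e. equality. [folklore] -/
theorem T_congr_ae : ∀ (k : ℕ) {g g' : (Fin (k + 2) → ℝ) → ℝ}, g =ᵐ[volume] g' →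
    T (k + 2) g =ᵐ[volume] T (k + 2) g'
  | 0, _, _, h => h
  | (k + 1), _, _, h => T_congr_ae k (pint_congr_ae h)

/-- `T (k+2)` commutes with negation. [folklore] -/
theorem T_neg : ∀ (k : ℕ) (g : (Fin (k + 2) → ℝ) → ℝ), T (k + 2) (-g) = -T (k + 2) g
  | 0, _ => rfl
  | (k + 1), g => by
    show T (k + 2) (pint (-g)) = -T (k + 2) (pint g)
    rw [pint_neg, T_neg k]

/-- `T (k+2)` is additive on integrable functions, a.e. [folklore] -/
theorem T_add_ae : ∀ (k : ℕ) {g g' : (Fin (k + 2) → ℝ) → ℝ}, Integrable g → Integrable g' →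
    T (k + 2) (g + g') =ᵐ[volume] T (k + 2) g + T (k + 2) g'
  | 0, _, _, _, _ => EventuallyEq.rfl
  | (k + 1), g, g', hg, hg' => by
    show T (k + 2) (pint (g + g')) =ᵐ[volume] T (k + 2) (pint g) + T (k + 2) (pint g')
    exact (T_congr_ae k (pint_add_ae hg hg')).trans
      (T_add_ae k (integrable_pint hg) (integrable_pint hg'))

/-- `T (k+2)` is subtractive on integrable functions, a.e. [folklore] -/
theorem T_sub_ae (k : ℕ) {g g' : (Fin (k + 2) → ℝ) → ℝ} (hg : Integrable g) (hg' : Integrable g') :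
    T (k + 2) (g - g') =ᵐ[volume] T (k + 2) g - T (k + 2) g' := by
  rw [sub_eq_add_neg, sub_eq_add_neg, ← T_neg]
  exact T_add_ae k hg hg'.neg

/-- `T (k+2)` of an a.e.-zero function is a.e. zero. [folklore] -/
theorem T_ae_zero (k : ℕ) {g : (Fin (k + 2) → ℝ) → ℝ} (hg : g =ᵐ[volume] 0) :
    T (k + 2) g =ᵐ[volume] 0 := by
  have h := T_congr_ae k hg
  have h0 : T (k + 2) (0 : (Fin (k + 2) → ℝ) → ℝ) = 0 := by
    have := T_neg k 0
    rw [neg_zero] at this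
    -- T 0 = - T 0 ⇒ T 0 = 0
    funext x
    have hx := congrFun this x
    simp only [Pi.neg_apply, Pi.zero_apply] at hx ⊢
    linarith
  rw [h0] at h
  exact h

/-! ## §3 The invariant `Φ` and the subgroup of a.e.-semialgebraic functions -/

/-- On generators: `ψ ⟨n, r⟩ = T n (1_{domain} · integrand)`. [folklore] -/
def ψ (s : Σ n, KZ.IntegralRep n) : (Fin 2 → ℝ) → ℝ := T s.1 (s.2.domain.indicator s.2.integrand)

/-- The invariant: additive extension of `ψ` to formal combinations. [folklore] -/
def Φ : KZ.FormalRep →+ ((Fin 2 → ℝ) → ℝ) := FreeAbelianGroup.lift ψ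

/-- Auxiliary: `Φ_of`. [folklore] -/
@[simp] theorem Φ_of {n : ℕ} (r : KZ.IntegralRep n) :
    Φ (KZ.of r) = T n (r.domain.indicator r.integrand) :=
  FreeAbelianGroup.lift_apply_of _ _

/-- The zero function is `ℚ`-semialgebraic on `ℝ²`. [folklore] -/
theorem isSemialgebraicFunOn_zero_univ :
    IsSemialgebraicFunOn ℚ (univ : Set (Fin 2 → ℝ)) (0 : (Fin 2 → ℝ) → ℝ) :=
  (isSemialgebraicFunOn_aeval (R := ℝ) isSemialgebraic_univ (0 : MvPolynomial (Fin 2) ℚ)).congr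
    fun x _ => by simp

/-- The subgroup of functions `ℝ² → ℝ` a.e. equal to a `ℚ`-semialgebraic function. [folklore] -/
def aeSemialg : AddSubgroup ((Fin 2 → ℝ) → ℝ) where
  carrier := {g | ∃ h : (Fin 2 → ℝ) → ℝ, IsSemialgebraicFunOn ℚ univ h ∧ g =ᵐ[volume] h}
  zero_mem' := ⟨0, isSemialgebraicFunOn_zero_univ, EventuallyEq.rfl⟩
  add_mem' := by
    rintro g g' ⟨h, hh, hg⟩ ⟨h', hh', hg'⟩
    exact ⟨h + h', IsSemialgebraicFunOn.add_holds hh hh', hg.add hg'⟩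
  neg_mem' := by
    rintro g ⟨h, hh, hg⟩
    exact ⟨-h, hh.neg, hg.neg⟩

/-- Auxiliary: `mem_aeSemialg_of_ae_zero`. [folklore] -/
theorem mem_aeSemialg_of_ae_zero {g : (Fin 2 → ℝ) → ℝ} (hg : g =ᵐ[volume] 0) : g ∈ aeSemialg :=
  ⟨0, isSemialgebraicFunOn_zero_univ, hg⟩

/-- Extension by zero of a semialgebraic function on a semialgebraic set is semialgebraic on the
whole space (no Tarski–Seidenberg needed). [folklore] -/
theorem isSemialgebraicFunOn_indicator_univ {m : ℕ} {s : Set (Fin m → ℝ)} {f : (Fin m → ℝ) → ℝ}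
    (hs : IsSemialgebraic ℚ s) (hf : IsSemialgebraicFunOn ℚ s f) :
    IsSemialgebraicFunOn ℚ univ (s.indicator f) := by
  rw [isSemialgebraicFunOn_iff] at hf ⊢
  have hzero : IsSemialgebraic ℚ {z : Fin (m + 1) → ℝ | z (Fin.last m) = 0} := by
    convert isSemialgebraic_setOf_eval_eq_zero (R := ℝ) (MvPolynomial.X (Fin.last m) :
      MvPolynomial (Fin (m + 1)) ℚ) using 1
    ext z; simp
  convert hf.union (hs.setOf_init_mem.compl.inter hzero) using 1
  ext z
  simp only [mem_univ, true_and, mem_setOf_eq, mem_union, mem_inter_iff, mem_compl_iff]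
  by_cases hz : Fin.init z ∈ s
  · simp [hz]
  · simp [hz]

/-! ## §4 The sub-calculus of rules (1) + (3) and its image under `Φ` -/

/-- The sub-calculus generated by the two additivity moves and the Newton–Leibniz move (no change
of variables). [folklore] -/
def addNLRelations : AddSubgroup KZ.FormalRep :=
  AddSubgroup.closure (KZ.domainAddRel ∪ KZ.integrandAddRel ∪ KZ.newtonLeibnizRel)

/-- `addNLRelations ≤ KZ.relations`. [folklore] -/
theorem addNLRelations_le_relations : addNLRelations ≤ KZ.relations := by
  refine (AddSubgroup.closure_le _).mpr ?_
  rintro c ((hc | hc) | hc)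
  · exact KZ.domainAddRel_subset_relations hc
  · exact KZ.integrandAddRel_subset_relations hc
  · exact KZ.newtonLeibnizRel_subset_relations hc

/-- Auxiliary: integrability of the extension by zero of a representation. [folklore] -/
theorem integrable_indicator_rep {n : ℕ} (r : KZ.IntegralRep n) :
    Integrable (r.domain.indicator r.integrand) :=
  (integrable_indicator_iff (KZ.IntegralRep.measurableSet_domain_holds r)).mpr r.integrableOn

/-- `Φ` of a domain-additivity relation is a.e. zero (dimension `≥ 2`) or zero. [folklore] -/
theorem Φ_mem_of_domainAddRel {c : KZ.FormalRep} (hc : c ∈ KZ.domainAddRel) : Φ c ∈ aeSemialg := by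
  obtain ⟨n, r, r₁, r₂, hdom, hnull, h₁, h₂, rfl⟩ := hc
  rcases n with _ | _ | k
  · refine mem_aeSemialg_of_ae_zero (Filter.Eventually.of_forall fun x => ?_)
    simp
  · refine mem_aeSemialg_of_ae_zero (Filter.Eventually.of_forall fun x => ?_)
    simp
  · simp only [map_sub, Φ_of]
    have hae : r.domain.indicator r.integrand =ᵐ[volume]
        r₁.domain.indicator r₁.integrand + r₂.domain.indicator r₂.integrand := by
      have hn : ∀ᵐ z : Fin (k + 2) → ℝ, z ∉ r₁.domain ∩ r₂.domain :=
        measure_eq_zero_iff_ae_notMem.mp hnull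
      filter_upwards [hn] with z hz
      simp only [Pi.add_apply]
      by_cases hz₁ : z ∈ r₁.domain
      · have hz₂ : z ∉ r₂.domain := fun h => hz ⟨hz₁, h⟩
        rw [Set.indicator_of_mem (hdom ▸ Or.inl hz₁), Set.indicator_of_mem hz₁,
          Set.indicator_of_notMem hz₂, add_zero, h₁ hz₁]
      · by_cases hz₂ : z ∈ r₂.domain
        · rw [Set.indicator_of_mem (hdom ▸ Or.inr hz₂), Set.indicator_of_notMem hz₁,
            Set.indicator_of_mem hz₂, zero_add, h₂ hz₂]
        · have hz' : z ∉ r.domain := by rw [hdom]; rintro (h | h) <;> contradiction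
          rw [Set.indicator_of_notMem hz', Set.indicator_of_notMem hz₁,
            Set.indicator_of_notMem hz₂, add_zero]
    refine mem_aeSemialg_of_ae_zero ?_
    have h1 := T_congr_ae k hae
    have h2 := T_add_ae k (integrable_indicator_rep r₁) (integrable_indicator_rep r₂)
    filter_upwards [h1, h2] with x hx1 hx2
    simp only [Pi.sub_apply, Pi.zero_apply, hx1, hx2, Pi.add_apply]
    ring

/-- `Φ` of an integrand-additivity relation is a.e. zero (dimension `≥ 2`) or zero. [folklore] -/
theorem Φ_mem_of_integrandAddRel {c : KZ.FormalRep} (hc : c ∈ KZ.integrandAddRel) :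
    Φ c ∈ aeSemialg := by
  obtain ⟨n, r, r₁, r₂, h₁, h₂, hadd, rfl⟩ := hc
  rcases n with _ | _ | k
  · refine mem_aeSemialg_of_ae_zero (Filter.Eventually.of_forall fun x => ?_)
    simp
  · refine mem_aeSemialg_of_ae_zero (Filter.Eventually.of_forall fun x => ?_)
    simp
  · simp only [map_sub, Φ_of]
    have hae : r.domain.indicator r.integrand =
        r₁.domain.indicator r₁.integrand + r₂.domain.indicator r₂.integrand := by
      funext z
      simp only [Pi.add_apply]
      by_cases hz : z ∈ r.domain
      · rw [Set.indicator_of_mem hz, Set.indicator_of_mem (h₁ ▸ hz),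
          Set.indicator_of_mem (h₂ ▸ hz), hadd hz, Pi.add_apply]
      · rw [Set.indicator_of_notMem hz, Set.indicator_of_notMem (h₁ ▸ hz),
          Set.indicator_of_notMem (h₂ ▸ hz), add_zero]
    refine mem_aeSemialg_of_ae_zero ?_
    have h2 := T_add_ae k (integrable_indicator_rep r₁) (integrable_indicator_rep r₂)
    rw [← hae] at h2
    filter_upwards [h2] with x hx2
    simp only [Pi.sub_apply, Pi.zero_apply, hx2, Pi.add_apply]
    ring

/-- **Fibrewise content of a Newton–Leibniz move**: integrating the band integrand along the last
coordinate gives, a.e. on the base, the boundary values `F(x, b x) − F(x, a x)` (Fubini for a.e.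
fibre integrability + the fundamental theorem of calculus, exactly as in
`KZ.eval_eq_zero_of_mem_newtonLeibnizRel_holds`). [folklore] -/
theorem pint_indicator_band_ae {n : ℕ} (r : KZ.IntegralRep (n + 1)) (r' : KZ.IntegralRep n)
    (a b : (Fin n → ℝ) → ℝ) (F : (Fin (n + 1) → ℝ) → ℝ)
    (hab : ∀ x ∈ r'.domain, a x ≤ b x)
    (hdom : r.domain = {z | (Fin.init z : Fin n → ℝ) ∈ r'.domain ∧ a (Fin.init z) ≤ z (Fin.last n) ∧
      z (Fin.last n) ≤ b (Fin.init z)})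
    (hcont : ∀ x ∈ r'.domain, ContinuousOn (fun t : ℝ => F (Fin.snoc x t)) (Icc (a x) (b x)))
    (hderiv : ∀ x ∈ r'.domain, ∀ t ∈ Ioo (a x) (b x),
      HasDerivAt (fun s : ℝ => F (Fin.snoc x s)) (r.integrand (Fin.snoc x t)) t)
    (hr' : ∀ x ∈ r'.domain, r'.integrand x = F (Fin.snoc x (b x)) - F (Fin.snoc x (a x))) :
    pint (r.domain.indicator r.integrand) =ᵐ[volume] r'.domain.indicator r'.integrand := by
  have hmem : ∀ x t, Fin.snoc x t ∈ r.domain ↔ x ∈ r'.domain ∧ t ∈ Icc (a x) (b x) := by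
    intro x t
    rw [hdom]
    simp only [mem_setOf_eq, Fin.init_snoc, Fin.snoc_last, mem_Icc]
  set G : (Fin (n + 1) → ℝ) → ℝ := r.domain.indicator r.integrand with hG_def
  have hG : Integrable G := integrable_indicator_rep r
  have hfib_in : ∀ x ∈ r'.domain, (fun t => G (Fin.snoc x t)) =
      (Icc (a x) (b x)).indicator (fun t => r.integrand (Fin.snoc x t)) := by
    intro x hx
    ext t
    by_cases ht : t ∈ Icc (a x) (b x)
    · rw [Set.indicator_of_mem ht, hG_def, Set.indicator_of_mem ((hmem x t).2 ⟨hx, ht⟩)]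
    · rw [Set.indicator_of_notMem ht, hG_def,
        Set.indicator_of_notMem (fun h => ht ((hmem x t).1 h).2)]
  have hfib_out : ∀ x ∉ r'.domain, (fun t => G (Fin.snoc x t)) = fun _ => 0 := by
    intro x hx
    ext t
    rw [hG_def, Set.indicator_of_notMem (fun h => hx ((hmem x t).1 h).1)]
  have hG2 : Integrable (fun p : (Fin n → ℝ) × ℝ => G (Fin.snoc p.1 p.2))
      ((volume : Measure (Fin n → ℝ)).prod volume) := integrable_comp_snoc_iff.mpr hG
  filter_upwards [hG2.prod_right_ae] with x hx
  show ∫ t, G (Fin.snoc x t) = r'.domain.indicator r'.integrand x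
  by_cases hxτ : x ∈ r'.domain
  · rw [Set.indicator_of_mem hxτ, hfib_in x hxτ, integral_indicator measurableSet_Icc,
      integral_Icc_eq_integral_Ioc, ← intervalIntegral.integral_of_le (hab x hxτ), hr' x hxτ]
    apply intervalIntegral.integral_eq_sub_of_hasDerivAt_of_le (hab x hxτ) (hcont x hxτ)
      (hderiv x hxτ)
    rw [intervalIntegrable_iff_integrableOn_Icc_of_le (hab x hxτ)]
    have hx' : Integrable (fun t => G (Fin.snoc x t)) := hx
    rw [hfib_in x hxτ] at hx'
    exact (integrable_indicator_iff measurableSet_Icc).mp hx'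
  · rw [Set.indicator_of_notMem hxτ, hfib_out x hxτ, integral_zero]

/-- `Φ` of a Newton–Leibniz relation lies in `aeSemialg`: zero for base dimension `0`, the
(semialgebraic) band integrand itself for base dimension `1`, a.e. zero for base dimension `≥ 2`.
[folklore] -/
theorem Φ_mem_of_newtonLeibnizRel {c : KZ.FormalRep} (hc : c ∈ KZ.newtonLeibnizRel) :
    Φ c ∈ aeSemialg := by
  obtain ⟨n, r, r', a, b, F, -, -, -, hab, hdom, hcont, hderiv, hr', rfl⟩ := hc
  rcases n with _ | _ | k
  · -- base dimension 0: both sides vanish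
    refine mem_aeSemialg_of_ae_zero (Filter.Eventually.of_forall fun x => ?_)
    simp
  · -- base dimension 1: `Φ [r] = 1_band · f`, semialgebraic on `ℝ²`; `Φ [r'] = 0`
    simp only [map_sub, Φ_of]
    have e1 : T (0 + 1 + 1) (r.domain.indicator r.integrand) = r.domain.indicator r.integrand := rfl
    have e2 : T (0 + 1) (r'.domain.indicator r'.integrand) = 0 := rfl
    rw [e1, e2, sub_zero]
    exact ⟨_, isSemialgebraicFunOn_indicator_univ r.isSemialgebraic_domain
      r.isSemialgebraicFunOn_integrand, EventuallyEq.rfl⟩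
  · -- base dimension k + 2 ≥ 2: `T (k+3) G = T (k+2) (pint G)` and `pint G =ᵐ G'`
    simp only [map_sub, Φ_of]
    rw [T_succ]
    refine mem_aeSemialg_of_ae_zero ?_
    have h := T_congr_ae k (pint_indicator_band_ae r r' a b F hab hdom hcont hderiv hr')
    filter_upwards [h] with x hx
    simp [hx]

/-- **The invariant kills rules (1) and (3)**: `Φ(addNLRelations) ⊆ aeSemialg`. [folklore] -/
theorem addNLRelations_le_comap : addNLRelations ≤ aeSemialg.comap Φ := by
  refine (AddSubgroup.closure_le _).mpr ?_
  rintro c ((hc | hc) | hc)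
  · exact Φ_mem_of_domainAddRel hc
  · exact Φ_mem_of_integrandAddRel hc
  · exact Φ_mem_of_newtonLeibnizRel hc

end NeedsCoV

end Summit.KontsevichZagierPeriods.Theorems.AperySectorThreeTwo.Negative

end
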